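import Literature.NumberTheory.Li1992.RallisLocalFactorEulerBoundsAssembly
import Literature.NumberTheory.Li1992.RallisLocalCoeffIntegrableAllPlaces
import HarnessLib

/-!
# [Li1992, Thm 2.1 (27)] — the Euler-exchange rows of the local factors for ARBITRARY factorizable data `Φ = ⊗Φ_v`, `Ψ = ⊗Ψ_v`

J.-S. Li, J. reine angew. Math. **428** (1992), Thm 2.1 p. 184: for FACTORIZABLE `φ₁, φ₂` the right-hand side of Rallis' inner product
formula is the absolutely convergent Euler product (27) `∏_v ∫_{H(F_v)} ⟨ω_v(h_v)φ_{1,v}, φ_{2,v}⟩ χ_v(h_v)⁻¹ dh_v`; almost every factor is the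
unramified one of §5 p. 206, and EVERY factor converges (stable range).  J. Tate, in Cassels–Fröhlich (1967), Thm 3.3.1: the exchange of
`∫` over a restricted product with `∏` of the local integrals needs every `f_v ∈ L¹` and bounded partial products of `∫ |f_v|`.

★ `exists_family_localFactor_rows` (`RallisLocalFactorEulerProduct.lean`) produced ONE factorizable test vector with these rows (and non-zero
factors).  THIS FILE proves the two `L¹` rows — plus `Σ_v |I_v − 1| < ∞` — for EVERY pair of restricted families `Φ, Ψ` of local
Schwartz–Bruhat functions equal to `1_{𝒪_vᴺ}` off a finite set `T_f`, for the rank-one member `U(J₁)` of the pair `(U(J), U(J₁))`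
(`dim J = N ≥ 3`) in the tree's currency (`ω_v = 𝓢.omegaLoc v ∘ localCenter`, `χ_{1,v} = localCharOfCenter χ₁ v`, local pairing on
`𝒮(F_vᴺ)` against `μ'_vᴺ` NORMALISED by `μ'_vᴺ(𝒪_vᴺ)⁻¹`, local left-invariant measures `ν^W_v` with `ν^W_v(U(J₁)(𝒪_v)) = 1` off `S₀`):

* **`localFactor_rows_of_pureTensor`** — for `fl_v(g) = (μ'_vᴺ(𝒪_vᴺ)⁻¹ • ⟨ω_v(g·1)Φ_v, Ψ_v⟩_{μ'_vᴺ}) · conj χ_{1,v}(g)`: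
  (1) `fl_v ∈ L¹(ν^W_v)` at EVERY `v` (★ `integrable_localCoeff`: split `v` by the Darboux∕coset bound, non-split `v` by compactness, times the
  unitary `χ_{1,v}`); (2) ONE bound for all partial products `∏_{v ∈ S} ∫ |fl_v| dν^W_v` (off `T_f ∪ S₀ ∪ T₁` the factor is the normalised
  spherical one, `≤ 1 + 4 N(v)^{-N/2}` by ★ `eventually_localFactor_unitVec_normalised_bounds`, and `Σ_v N(v)^{-N/2} < ∞` for `N ≥ 3`);
  (3) `Σ_v |∫ fl_v − 1| < ∞` (`|I_v − 1| ≤ 12 N(v)^{-N/2}` off the same finite set);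
* **`localFactor_rows_of_pureTensor_trivialChar`** — the same three rows for the character-free factors
  `fl_v(g) = μ'_vᴺ(𝒪_vᴺ)⁻¹ • ⟨ω_v(g·1)Φ_v, Ψ_v⟩_{μ'_vᴺ}` (`χ₁ = 1`).

These are exactly the rows `hfl`, `hB` of the cell's finite-adelic integrability exchange (`Theorems/H413FinAdelicPureTensorIntegrable`,
`Theorems/H413FinCoeffIntegrable`) for general pure tensors.  KERNEL only: theorems, no definition, no named fact, no `sorry`.  Cell
hodgecm-mathlib, FLOOR 0, programme P4 ∕ E-2 road C (`hF`), crux item H413 (`--supports stmt-HodgeConjecture-24833`).  HC_CM is proved only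
modulo the printed citations until rung 0 closes; nothing here is a claim about them.

## References
* [Li1992] J.-S. Li, J. reine angew. Math. 428 (1992) 177–217 — Thm 2.1 (26)–(27) p. 184; §5 p. 206.
* [TateThesis1967] J. Tate, in Cassels–Fröhlich, *Algebraic Number Theory* (1967), Ch. XV §3.2 Lemma 3.2.1, Thm 3.3.1.
* [GelbartRogawski1991] S. Gelbart, J. Rogawski, Invent. Math. 105 (1991), §3.1 Prop. 3.1.1.
-/

set_option autoImplicit false

noncomputable section

open NumberField IsDedekindDomain MeasureTheory Filter Set
open scoped Matrix NNReal Topology ComplexConjugate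
open Literature.RepresentationTheory Literature.RepresentationTheory.HeisenbergGroup
open Literature.NumberTheory.Automorphic
open Literature.NumberTheory.Automorphic.UnitaryGroup
open Literature.NumberTheory.Automorphic.Liu2021
open Literature.NumberTheory.GaloisRepresentations.IsNonarchimedeanLocalField

namespace Literature.NumberTheory.GelbartRogawski1991.UnitaryDualPair.LocalSplitting.FinLocalSplittings

variable {F : Type} [Field F] [NumberField F] {E : Type} [Field E] [NumberField E] [Algebra F E]
  [Algebra.IsQuadraticExtension F E] {c : E ≃ₐ[F] E} {N : ℕ} {δ : E} {hcδ : c δ = -δ} {hδ : δ ≠ 0} {d : F}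
  {hd : δ * δ = algebraMap F E d} {T : Matrix (Fin N) (Fin N) F} {hT : T.IsSymm}
  {J : Matrix (Fin N) (Fin N) E} {hJ : J = T.map (algebraMap F E)}
  (𝓢 : FinLocalSplittings F E c N hcδ hδ hd T hT hJ) (J₁ : Matrix (Fin 1) (Fin 1) E) (hJ₁ : J₁ 0 0 ≠ 0)
  (hTd : IsUnit T.det)

include hTd in
/-- **[Li1992 (27)] — THE `L¹` ROWS OF THE EULER EXCHANGE FOR ARBITRARY FACTORIZABLE DATA.**  For a restricted family `𝓢` of local splittings with
`ω_v` `L²(μ'_vᴺ)`-isometric, `dim J = N ≥ 3`, a continuous unitary character `χ₁` of `E¹(𝔸_{F,f})`, local left-invariant measures `ν^W_v` on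
`U(J₁)(F_v)` (finite on compacts, charging open sets) with `ν^W_v(U(J₁)(𝒪_v)) = 1` off a finite `S₀`, and ANY two restricted families `Φ, Ψ` of
local Schwartz–Bruhat functions with `Φ_v = Ψ_v = 1_{𝒪_vᴺ}` off a finite `T_f`: the normalised local factors
`fl_v(g) = (μ'_vᴺ(𝒪_vᴺ)⁻¹ • ⟨ω_v(g·1)Φ_v, Ψ_v⟩_{μ'_vᴺ}) · conj χ_{1,v}(g)` are ALL integrable, their `L¹` partial products are bounded by ONE
constant, and `Σ_v |∫ fl_v − 1| < ∞` — the rows under which `∫_{U(J₁)(𝔸_{F,f})} ⊗'_v fl_v = ∏'_v ∫ fl_v` ([TateThesis1967, Thm 3.3.1]) for the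
factorizable data of [Li1992, (27)].  [cite: Li1992, Thm 2.1 (27) p. 184; §5 p. 206] [cite: TateThesis1967, Thm 3.3.1] -/
theorem localFactor_rows_of_pureTensor (h3 : 3 ≤ N) (hJ₁c : (J₁.map c)ᵀ = J₁)
    {χ₁ : finAdelicOne F E c →* ℂˣ} (hχ₁ : Continuous χ₁) (hχ₁u : ∀ x, ‖((χ₁ x : ℂˣ) : ℂ)‖ = 1)
    [∀ v : HeightOneSpectrum (𝓞 F), MeasurableSpace (v.adicCompletion F)] [∀ v : HeightOneSpectrum (𝓞 F), BorelSpace (v.adicCompletion F)]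
    (μ' : ∀ v : HeightOneSpectrum (𝓞 F), Measure (v.adicCompletion F)) [∀ v, (μ' v).IsAddHaarMeasure]
    (hL2 : ∀ v : HeightOneSpectrum (𝓞 F), (𝓢.omegaLoc v).IsL2Isometric (Measure.pi fun _ : Fin N => μ' v))
    [∀ v : HeightOneSpectrum (𝓞 F), MeasurableSpace (localPi E c 1 J₁ v)] [∀ v : HeightOneSpectrum (𝓞 F), BorelSpace (localPi E c 1 J₁ v)]
    (νW : ∀ v : HeightOneSpectrum (𝓞 F), Measure (localPi E c 1 J₁ v)) [∀ v, (νW v).IsMulLeftInvariant]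
    [∀ v, IsFiniteMeasureOnCompacts (νW v)] [∀ v, (νW v).IsOpenPosMeasure]
    (S₀ : Finset (HeightOneSpectrum (𝓞 F))) (hB1 : ∀ v, v ∉ S₀ → νW v (localInt E c 1 J₁ v : Set (localPi E c 1 J₁ v)) = 1)
    (Tf : Finset (HeightOneSpectrum (𝓞 F))) (Φ Ψ : LocalSBFamily F (Fin N))
    (hΦ : ∀ v, v ∉ Tf → Φ v = unitVec F (Fin N) v) (hΨ : ∀ v, v ∉ Tf → Ψ v = unitVec F (Fin N) v)
    (fl : ∀ v : HeightOneSpectrum (𝓞 F), localPi E c 1 J₁ v → ℂ)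
    (hfl_def : fl = fun (v : HeightOneSpectrum (𝓞 F)) (g : localPi E c 1 J₁ v) =>
      (((Measure.pi fun _ : Fin N => μ' v) (integralBox F (Fin N) v)).toReal⁻¹ •
        ∫ x, ((𝓢.omegaLoc v (localCenter E c N J J₁ hJ₁ v g) (Φ v) :
            SchwartzBruhat (Fin N → v.adicCompletion F)) : (Fin N → v.adicCompletion F) → ℂ) x *
          conj (((Ψ v : SchwartzBruhat (Fin N → v.adicCompletion F)) : (Fin N → v.adicCompletion F) → ℂ) x)
          ∂(Measure.pi fun _ : Fin N => μ' v)) *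
        conj ((localCharOfCenter F E c J₁ hJ₁ χ₁ v g : ℂˣ) : ℂ)) :
    (∀ v, Integrable (fl v) (νW v)) ∧
    (∃ B : ℝ, ∀ S : Finset (HeightOneSpectrum (𝓞 F)), ∏ v ∈ S, ∫ g, ‖fl v g‖ ∂νW v ≤ B) ∧
    (Summable fun v => ‖(∫ g, fl v g ∂νW v) - 1‖) := by
  classical
  haveI : NeZero N := ⟨by omega⟩
  have h2 : 2 ≤ N := by omega
  have hc : c ≠ 1 := by
    rintro rfl
    exact hδ (self_eq_neg.1 (by simpa only [AlgEquiv.one_apply] using hcδ))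
  -- `fl v = C_v⁻¹ • (unnormalised integrand · conj χ_{1,v})`
  have hflv : ∀ v, fl v = fun g => ((Measure.pi fun _ : Fin N => μ' v) (integralBox F (Fin N) v)).toReal⁻¹ •
      ((∫ x, ((𝓢.omegaLoc v (localCenter E c N J J₁ hJ₁ v g) (Φ v) :
            SchwartzBruhat (Fin N → v.adicCompletion F)) : (Fin N → v.adicCompletion F) → ℂ) x *
          conj (((Ψ v : SchwartzBruhat (Fin N → v.adicCompletion F)) : (Fin N → v.adicCompletion F) → ℂ) x)
          ∂(Measure.pi fun _ : Fin N => μ' v)) * conj ((localCharOfCenter F E c J₁ hJ₁ χ₁ v g : ℂˣ) : ℂ)) := by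
    intro v
    rw [hfl_def]
    funext g
    simp only [smul_mul_assoc]
  -- ROW 1, at EVERY place: ★ `integrable_localCoeff` times the bounded continuous `conj χ_{1,v}`, rescaled
  have hint_all : ∀ v, Integrable (fl v) (νW v) := fun v => by
    have hχm : AEStronglyMeasurable
        (fun g : localPi E c 1 J₁ v => conj ((localCharOfCenter F E c J₁ hJ₁ χ₁ v g : ℂˣ) : ℂ)) (νW v) :=
      (Complex.continuous_conj.comp (continuous_coe_localCharOfCenter F E c J₁ hJ₁ hχ₁ v)).aestronglyMeasurable
    have hχb : ∀ᵐ g ∂(νW v), ‖conj ((localCharOfCenter F E c J₁ hJ₁ χ₁ v g : ℂˣ) : ℂ)‖ ≤ 1 :=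
      Filter.Eventually.of_forall fun g => by
        rw [Complex.norm_conj, norm_localCharOfCenter F E c J₁ hJ₁ hχ₁u v g]
    rw [hflv v]
    exact ((𝓢.integrable_localCoeff J₁ hJ₁ hTd v hc hJ₁c (μ' v) (hL2 v) (νW v) (Φ v) (Ψ v)).mul_bdd hχm hχb).smul
      (((Measure.pi fun _ : Fin N => μ' v) (integralBox F (Fin N) v)).toReal⁻¹)
  -- OFF `Tf ∪ S₀ ∪ T₁`: the normalised spherical rows
  have key_off : ∀ᶠ v : HeightOneSpectrum (𝓞 F) in cofinite,
      ‖(∫ g, fl v g ∂νW v) - 1‖ ≤ 12 * (Ideal.absNorm v.asIdeal : ℝ) ^ (-((N : ℝ) / 2)) ∧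
        ∫ g, ‖fl v g‖ ∂νW v ≤ 1 + 4 * (Ideal.absNorm v.asIdeal : ℝ) ^ (-((N : ℝ) / 2)) := by
    filter_upwards [𝓢.eventually_localFactor_unitVec_normalised_bounds J₁ hJ₁ hTd hJ₁c h2 hχ₁ hχ₁u μ' hL2,
      S₀.eventually_cofinite_notMem, Tf.eventually_cofinite_notMem] with v hv hS hT
    obtain ⟨-, hI, hA⟩ := hv (νW v) (hB1 v hS)
    rw [hfl_def]
    simp only [hΦ v hT, hΨ v hT]
    exact ⟨hI, hA⟩
  have hsum3 := Li1992.summable_absNorm_rpow_neg_half_of_three_le F h3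
  refine ⟨hint_all, ?_, ?_⟩
  · -- ROW 2: bounded partial products
    exact Li1992.exists_prod_le_of_eventually_le_one_add (fun v => ∫ g, ‖fl v g‖ ∂νW v)
      (fun v => 4 * (Ideal.absNorm v.asIdeal : ℝ) ^ (-((N : ℝ) / 2))) (fun v => integral_nonneg fun g => norm_nonneg _)
      (fun v => mul_nonneg (by norm_num) (Real.rpow_nonneg (Nat.cast_nonneg _) _)) (hsum3.mul_left 4)
      (key_off.mono fun v hv => hv.2)
  · -- ROW 3: `Σ_v ‖I_v − 1‖ < ∞`
    exact Li1992.summable_norm_sub_one_of_eventually_le (fun v => ∫ g, fl v g ∂νW v)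
      (fun v => 12 * (Ideal.absNorm v.asIdeal : ℝ) ^ (-((N : ℝ) / 2))) (hsum3.mul_left 12)
      (key_off.mono fun v hv => hv.1)

include hTd in
/-- **Character-free form** (`χ₁ = 1`): for ANY two restricted families `Φ, Ψ` (`= 1_{𝒪_vᴺ}` off a finite `T_f`) the normalised local matrix
coefficients `fl_v(g) = μ'_vᴺ(𝒪_vᴺ)⁻¹ • ⟨ω_v(g·1)Φ_v, Ψ_v⟩_{μ'_vᴺ}` are ALL `ν^W_v`-integrable, with `L¹` partial products bounded by ONE
constant and `Σ_v |∫ fl_v − 1| < ∞` — the rows `hfl`, `hB` of the finite-adelic integrability exchange for `b ↦ ⟨ω_f(b)(⊗Φ_v), ⊗Ψ_v⟩`.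
[cite: Li1992, Thm 2.1 (27) p. 184; §5 p. 206] [cite: TateThesis1967, Thm 3.3.1] -/
theorem localFactor_rows_of_pureTensor_trivialChar (h3 : 3 ≤ N) (hJ₁c : (J₁.map c)ᵀ = J₁)
    [∀ v : HeightOneSpectrum (𝓞 F), MeasurableSpace (v.adicCompletion F)] [∀ v : HeightOneSpectrum (𝓞 F), BorelSpace (v.adicCompletion F)]
    (μ' : ∀ v : HeightOneSpectrum (𝓞 F), Measure (v.adicCompletion F)) [∀ v, (μ' v).IsAddHaarMeasure]
    (hL2 : ∀ v : HeightOneSpectrum (𝓞 F), (𝓢.omegaLoc v).IsL2Isometric (Measure.pi fun _ : Fin N => μ' v))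
    [∀ v : HeightOneSpectrum (𝓞 F), MeasurableSpace (localPi E c 1 J₁ v)] [∀ v : HeightOneSpectrum (𝓞 F), BorelSpace (localPi E c 1 J₁ v)]
    (νW : ∀ v : HeightOneSpectrum (𝓞 F), Measure (localPi E c 1 J₁ v)) [∀ v, (νW v).IsMulLeftInvariant]
    [∀ v, IsFiniteMeasureOnCompacts (νW v)] [∀ v, (νW v).IsOpenPosMeasure]
    (S₀ : Finset (HeightOneSpectrum (𝓞 F))) (hB1 : ∀ v, v ∉ S₀ → νW v (localInt E c 1 J₁ v : Set (localPi E c 1 J₁ v)) = 1)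
    (Tf : Finset (HeightOneSpectrum (𝓞 F))) (Φ Ψ : LocalSBFamily F (Fin N))
    (hΦ : ∀ v, v ∉ Tf → Φ v = unitVec F (Fin N) v) (hΨ : ∀ v, v ∉ Tf → Ψ v = unitVec F (Fin N) v)
    (fl : ∀ v : HeightOneSpectrum (𝓞 F), localPi E c 1 J₁ v → ℂ)
    (hfl_def : fl = fun (v : HeightOneSpectrum (𝓞 F)) (g : localPi E c 1 J₁ v) =>
      ((Measure.pi fun _ : Fin N => μ' v) (integralBox F (Fin N) v)).toReal⁻¹ •
        ∫ x, ((𝓢.omegaLoc v (localCenter E c N J J₁ hJ₁ v g) (Φ v) :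
            SchwartzBruhat (Fin N → v.adicCompletion F)) : (Fin N → v.adicCompletion F) → ℂ) x *
          conj (((Ψ v : SchwartzBruhat (Fin N → v.adicCompletion F)) : (Fin N → v.adicCompletion F) → ℂ) x)
          ∂(Measure.pi fun _ : Fin N => μ' v)) :
    (∀ v, Integrable (fl v) (νW v)) ∧
    (∃ B : ℝ, ∀ S : Finset (HeightOneSpectrum (𝓞 F)), ∏ v ∈ S, ∫ g, ‖fl v g‖ ∂νW v ≤ B) ∧
    (Summable fun v => ‖(∫ g, fl v g ∂νW v) - 1‖) := by
  have h1c : Continuous (1 : finAdelicOne F E c →* ℂˣ) := continuous_const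
  have h1u : ∀ x, ‖(((1 : finAdelicOne F E c →* ℂˣ) x : ℂˣ) : ℂ)‖ = 1 := fun x => by
    rw [MonoidHom.one_apply, Units.val_one, norm_one]
  refine 𝓢.localFactor_rows_of_pureTensor J₁ hJ₁ hTd h3 hJ₁c h1c h1u μ' hL2 νW S₀ hB1 Tf Φ Ψ hΦ hΨ fl ?_
  rw [hfl_def]
  funext v g
  rw [localCharOfCenter_eq_comp_inclPlace, MonoidHom.one_comp, MonoidHom.one_comp, MonoidHom.one_apply, Units.val_one, map_one,
    mul_one]

end Literature.NumberTheory.GelbartRogawski1991.UnitaryDualPair.LocalSplitting.FinLocalSplittings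

end
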